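import Mathlib
import Summits.Schanuel.Schanuel.Theorems.DiophantineDichotomyDefs

/-!
# Sketch (crux-ideate round 1, ideator 2) — crux `KhovanskiiApproxTypeEv` (stmt-Schanuel-14972)

Vocabulary and the first checkable statements of the idea card
`subfield-descent-transfer` (relative Siegel-in-the-ideal over a SMALL subfield `ℚ(κ)` of the
challenger's field + a Lindemann–Weierstrass measure with an ALGEBRAIC PARAMETER `κ`, sharp in
`[ℚ(κ):ℚ]` — `MixedLWMeasure`; the eventual form of the crux absorbs every height-free penalty).

Nothing here is asserted except the `Iff.rfl` reassembly `khovanskiiApproxTypeEv_iff` and the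
bookkeeping lemma `relKill_shape` (mean value step), whose analytic proof is left as the one `sorry`.
-/

noncomputable section

set_option linter.dupNamespace false

open scoped BigOperators

namespace Summit.Schanuel.Schanuel.Cruxes.KhovanskiiApproxTypeEv.IdeateR1K2

open Summit.Schanuel.Schanuel.Theses.DiophantineDichotomy (KhovanskiiApproxTypeEv KhovanskiiApproxType)
open Summit.Schanuel.Schanuel.Cruxes.KhovanskiiApproxType.LwSmallHeight
open Literature.NumberTheory.Transcendental (weilHeight₁)
open IntermediateField

/-! ## The crux, pointwise -/

/-- EVENTUAL approximation type `(a, b, C)` at `θ = (s, e^s) ∈ ℂ²ⁿ` — verbatim the tail of the crux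
`KhovanskiiApproxTypeEv`: for every degree budget `d` a threshold `H₀(d)` beyond which every algebraic
challenger `γ` at level `(d, H)` satisfies `‖γ − θ‖ ≥ exp(−C(dᵃ log H + dᵇ))`. -/
def ApproxTypeEvAt (n : ℕ) (s : Fin n → ℂ) (a b C : ℝ) : Prop :=
  0 < C ∧ ∀ d : ℕ, ∃ H₀ : ℕ, ∀ (H : ℕ) (γ : Fin n ⊕ Fin n → ℂ), H₀ ≤ H →
    Module.finrank ℚ ↥(IntermediateField.adjoin ℚ (Set.range γ)) ≤ d →
    (∀ i, ∃ P : Polynomial ℤ, P ≠ 0 ∧ P.natDegree ≤ d ∧ (∀ k, |P.coeff k| ≤ (H : ℤ)) ∧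
      Polynomial.aeval (γ i) P = 0) →
    Real.exp (-(C * ((d : ℝ) ^ a * Real.log H + (d : ℝ) ^ b))) ≤ ‖γ - Sum.elim s (Complex.exp ∘ s)‖

/-- The crux is, by `Iff.rfl`, the pointwise statement over free Khovanskii points. -/
theorem khovanskiiApproxTypeEv_iff :
    KhovanskiiApproxTypeEv ↔ ∀ (n : ℕ) (s : Fin n → ℂ), 2 ≤ n → LinearIndependent ℚ s →
      IsFreeKhovanskii n s → ∃ a b C : ℝ, a < 1 / ((n : ℝ) - 1) ∧ ApproxTypeEvAt n s a b C :=
  Iff.rfl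

/-- Exponent form of the eventual type (NOTES §1): at fixed `d` only the growth `w(d)` of the exponent on
`log H` matters — `‖γ − θ‖ ≥ c_d · H^{−w d}` for all level-`d` challengers, `c_d > 0` arbitrary. -/
def ExponentBoundAt (n : ℕ) (s : Fin n → ℂ) (w : ℕ → ℝ) : Prop :=
  ∀ d : ℕ, ∃ c : ℝ, 0 < c ∧ ∀ (H : ℕ) (γ : Fin n ⊕ Fin n → ℂ), 1 ≤ H →
    Module.finrank ℚ ↥(IntermediateField.adjoin ℚ (Set.range γ)) ≤ d →
    (∀ i, ∃ P : Polynomial ℤ, P ≠ 0 ∧ P.natDegree ≤ d ∧ (∀ k, |P.coeff k| ≤ (H : ℤ)) ∧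
      Polynomial.aeval (γ i) P = 0) →
    c * (H : ℝ) ^ (-(w d)) ≤ ‖γ - Sum.elim s (Complex.exp ∘ s)‖

/-- Bookkeeping target (provable now, NOTES §1): a power-law exponent bound `w d ≤ C dᵃ` IS an eventual
type `(a, b, C')` for any `b` (take `H₀(d)` with `c_d ≥ H₀^{-1}`…), and conversely up to `C ↦ C + 1`. -/
def ExponentFormEquiv : Prop :=
  ∀ (n : ℕ) (s : Fin n → ℂ) (a : ℝ), 0 ≤ a →
    ((∃ b C : ℝ, ApproxTypeEvAt n s a b C) ↔
      ∃ C : ℝ, 0 < C ∧ ExponentBoundAt n s (fun d => C * (max 1 (d : ℝ)) ^ a))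

/-! ## Relations over `ℤ[κ]` in a box, and the mixed Lindemann–Weierstrass measure -/

/-- Evaluation of a "relation with algebraic parameter": `T = (T_μ)_μ`, `T_μ ∈ ℤ[Y]`, at `Y = κ`,
`X = x`: `Σ_{μ ∈ S} T_μ(κ) · x^μ`. -/
def evalRel {m : ℕ} (S : Finset (Fin m →₀ ℕ)) (T : (Fin m →₀ ℕ) → Polynomial ℤ) (κ : ℂ)
    (x : Fin m → ℂ) : ℂ :=
  ∑ μ ∈ S, Polynomial.aeval κ (T μ) * ∏ j, x j ^ (μ j)

/-- **MixedLWMeasure** `m ω C pen` — a Lindemann–Weierstrass-type measure at `ω ∈ ℂᵐ` for integer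
relations with an ALGEBRAIC PARAMETER `κ` of degree `e` (root of a non-zero integer polynomial of degree
`e` and height `≤ Hκ`), SHARP IN `e`: for `T_μ ∈ ℤ[Y]` of degree `< e`, coefficients `≤ B`, supported on
`N = |S|` monomials of partial degrees `≤ δ`, if `Σ T_μ(κ) ω^μ ≠ 0` then
`log|Σ T_μ(κ) ω^μ| ≥ −C·e·max(N, e)·(log B + log Hκ) − pen(e, N, δ)`,
with `pen` an ARBITRARY height-free penalty (harmless for the eventual crux).  Dirichlet count:
`B^{eN}` relations ⇒ the factor `e·N` is forced; Wirsing approximants (`N = 1`, `T = Y`, `κ → ω₁`) force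
`max(N, e)` instead of `N`.  The norm trick (eliminate `κ`) proves the shape with `e·max(N,e)` replaced by
`e^{m+1}·δᵐ` (Ably 1994 / Mahler 1932 applied to `Res_Y(P_κ, T)`): the content of the stub is removing
that loss — Siegel–Shidlovskii over the coefficient field `ℚ(κ)`, field-sharp. -/
def MixedLWMeasure (m : ℕ) (ω : Fin m → ℂ) (C : ℝ) (pen : ℕ → ℕ → ℕ → ℝ) : Prop :=
  0 < C ∧ ∀ (e : ℕ) (κ : ℂ) (Hκ : ℕ) (Pκ : Polynomial ℤ), 1 ≤ e → Pκ ≠ 0 → Pκ.natDegree = e →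
    (∀ k, |Pκ.coeff k| ≤ (Hκ : ℤ)) → Polynomial.aeval κ Pκ = 0 →
    Module.finrank ℚ ↥(ℚ⟮κ⟯) = e →
    ∀ (S : Finset (Fin m →₀ ℕ)) (δ B : ℕ) (T : (Fin m →₀ ℕ) → Polynomial ℤ),
      (∀ μ ∈ S, ∀ j, μ j ≤ δ) → (∀ μ ∈ S, (T μ).natDegree < e) →
      (∀ μ ∈ S, ∀ k, |(T μ).coeff k| ≤ (B : ℤ)) →
      evalRel S T κ ω ≠ 0 →
      Real.exp (-(C * e * max (S.card : ℝ) e * (Real.log (max 1 (B : ℝ)) + Real.log (max 1 (Hκ : ℝ)))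
          + pen e S.card δ)) ≤ ‖evalRel S T κ ω‖

/-- **MixedLW** — the input stub of the card at Lindemann–Weierstrass tuples: for `s ∈ ℚ̄ᵐ`
`ℚ`-linearly independent, `ω = e^{s}` carries a mixed measure with SOME constant and SOME penalty
(eventual/ineffective thresholds allowed: they live in `pen`). Printed weaker form: norm trick + Ably 1994
Théorème p. 30 (loss `e^m`); field-sharp form: to be located (Shidlovskii's measures over `𝕂`,
Nesterenko–Shidlovskii 1996) or proved (Siegel's method run over `ℚ(κ, s)`, Liouville once). -/
def MixedLW : Prop :=
  ∀ (m : ℕ) (s : Fin m → ℂ), 1 ≤ m → (∀ i, IsAlgebraic ℚ (s i)) → LinearIndependent ℚ s →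
    ∃ (C : ℝ) (pen : ℕ → ℕ → ℕ → ℝ), MixedLWMeasure m (Complex.exp ∘ s) C pen

/-- **SiegelBoxShape** `m A E` — Siegel's lemma inside the ideal of the challenger, RELATIVE to the
subfield `ℚ(κ)` but solved over `ℤ` (discriminant-free, as the landed `SiegelInIdeal`): for a number
field `F ∋ κ` (`κ` of degree `e`), a point `β ∈ Fᵐ` and a box of partial degree `δ` with
`e·(δ+1)ᵐ ≥ A([F:ℚ]+1)` unknowns, there is a non-zero relation `Σ T_μ(κ) β^μ = 0`, `deg T_μ < e`, with
`log|coeff| ≤ E·(e·h(κ) + δ·Σ h(β_j)) + E·log(e(δ+1)ᵐ)` (absolute logarithmic Weil heights in `F`). -/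
def SiegelBoxShape (m : ℕ) (A E : ℝ) : Prop :=
  ∀ (e : ℕ) (κ : ℂ) (F : IntermediateField ℚ ℂ) [FiniteDimensional ℚ F] (β : Fin m → ℂ),
    1 ≤ e → Module.finrank ℚ ↥(ℚ⟮κ⟯) = e → κ ∈ F → (∀ j, β j ∈ F) →
    ∀ δ : ℕ, A * ((Module.finrank ℚ F : ℝ) + 1) ≤ e * ((δ : ℝ) + 1) ^ m →
      ∃ (S : Finset (Fin m →₀ ℕ)) (T : (Fin m →₀ ℕ) → Polynomial ℤ),
        (∃ μ ∈ S, T μ ≠ 0) ∧ (∀ μ ∈ S, ∀ j, μ j ≤ δ) ∧ (∀ μ ∈ S, (T μ).natDegree < e) ∧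
        evalRel S T κ β = 0 ∧
        ∀ μ ∈ S, ∀ k, (|(T μ).coeff k| : ℝ) ≤ ((e : ℝ) * ((δ : ℝ) + 1) ^ m) ^ E *
          Real.exp (E * ((e : ℝ) * weilHeight₁ F (fun _ : Unit => κ) +
            δ * ∑ j, weilHeight₁ F (fun _ : Unit => β j)))

/-- `SiegelBox` — some shape `(A, E)` holds in every number of variables (provable now: box principle in
one complex embedding + the archimedean Liouville inequality, exactly as `stub_siegelInIdeal` p76390). -/
def SiegelBox : Prop :=
  ∀ m : ℕ, 1 ≤ m → ∃ A E : ℝ, 0 < A ∧ 0 ≤ E ∧ SiegelBoxShape m A E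

/-! ## First lemma: the relative kill (mean value step) -/

/-- **First lemma of the line (shape).**  A mixed measure at `ω` turns every relation over `ℤ[κ]`
satisfied by a point `β` into a LOWER bound for `‖β − ω‖`: `|Σ T_μ(κ)ω^μ| = |Σ T_μ(κ)(ω^μ − β^μ)| ≤
‖∇‖·‖ω − β‖` on the unit ball, against the measure.  The cost `C·e·max(N,e)·(log B + log Hκ)` is what the
card prices: with `B` from `SiegelBoxShape` it reads `≍ δ·Σh(β) ` (relative transfer, exponent
`k^{1/m}` in the RELATIVE degree `k = [F:ℚ(κ)]`) ` + [F:ℚ]·log Hκ` (the subfield generator's height —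
small generator ⇔ small root discriminant), and every height-free term is absorbed by the eventual
threshold.  Analytic proof (mean value + monomial bookkeeping) left as the one `sorry` of this sketch. -/
theorem relKill_shape {m : ℕ} (ω : Fin m → ℂ) (C : ℝ) (pen : ℕ → ℕ → ℕ → ℝ)
    (hLW : MixedLWMeasure m ω C pen)
    (e : ℕ) (κ : ℂ) (Hκ : ℕ) (Pκ : Polynomial ℤ) (he : 1 ≤ e) (hP0 : Pκ ≠ 0)
    (hPdeg : Pκ.natDegree = e) (hPH : ∀ k, |Pκ.coeff k| ≤ (Hκ : ℤ)) (hPκ : Polynomial.aeval κ Pκ = 0)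
    (hdeg : Module.finrank ℚ ↥(ℚ⟮κ⟯) = e)
    (S : Finset (Fin m →₀ ℕ)) (δ B : ℕ) (T : (Fin m →₀ ℕ) → Polynomial ℤ)
    (hbox : ∀ μ ∈ S, ∀ j, μ j ≤ δ) (hTdeg : ∀ μ ∈ S, (T μ).natDegree < e)
    (hTB : ∀ μ ∈ S, ∀ k, |(T μ).coeff k| ≤ (B : ℤ))
    (β : Fin m → ℂ) (hrel : evalRel S T κ β = 0) (hval : evalRel S T κ ω ≠ 0)
    (hclose : ‖β - ω‖ ≤ 1) :
    Real.exp (-(C * e * max (S.card : ℝ) e * (Real.log (max 1 (B : ℝ)) + Real.log (max 1 (Hκ : ℝ)))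
        + pen e S.card δ))
      ≤ (S.card * (max 1 (B : ℝ)) * e * (max 1 ‖κ‖) ^ e * (m * δ + 1) * (1 + ‖ω‖) ^ (m * δ)) *
        ‖β - ω‖ := by
  sorry

/-- **RelativeTransferEv** — the statement the card adds to the exponent game at a Lindemann–Weierstrass
point `θ = (s, e^s) ∈ ℂ²ⁿ` (registered-stub shape for crux-plan): `MixedLW ∧ SiegelBox` imply that a
challenger whose coordinates split as (a generator `κ` of a subfield, of degree `e` and height `Hκ`) +
(a tuple `β` of RELATIVE degree `k` over `ℚ(κ)`, heights `≤ H`) is repelled at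
`exp(−C'(k^{1/(n−1)}·log H + [ℚ(κ,β):ℚ]·log Hκ) − pen')` — EVENTUALLY in `H` at each level `d`, i.e. with
the penalty folded into the threshold.  Small generator (`log Hκ ≤ (log H)/d^{1/2+η}`) ⇒ exponent
`(1−x)/(n−1)` against the floor's `x` (`e = dˣ`): game value `1/n`, the optimal one. -/
def RelativeTransferEv : Prop :=
  MixedLW → SiegelBox →
    ∀ (n : ℕ) (s : Fin n → ℂ), 2 ≤ n → (∀ i, IsAlgebraic ℚ (s i)) → LinearIndependent ℚ s →
      ∃ C' : ℝ, 0 < C' ∧ ∀ d : ℕ, ∃ H₀ : ℕ, ∀ (H : ℕ) (e Hκ : ℕ) (κ : ℂ)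
        (F : IntermediateField ℚ ℂ) (_ : FiniteDimensional ℚ F) (α : Fin n → ℂ),
        H₀ ≤ H → 1 ≤ e → Module.finrank ℚ ↥(ℚ⟮κ⟯) = e → κ ∈ F → (∀ j, α j ∈ F) →
        Module.finrank ℚ F ≤ d →
        (∃ P : Polynomial ℤ, P ≠ 0 ∧ P.natDegree = e ∧ (∀ k, |P.coeff k| ≤ (Hκ : ℤ)) ∧
          Polynomial.aeval κ P = 0) →
        (∀ j, ∃ P : Polynomial ℤ, P ≠ 0 ∧ P.natDegree ≤ d ∧ (∀ k, |P.coeff k| ≤ (H : ℤ)) ∧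
          Polynomial.aeval (α j) P = 0) →
        Real.exp (-(C' * (((Module.finrank ℚ F : ℝ) / e) ^ (1 / ((n : ℝ) - 1)) * Real.log H +
            (Module.finrank ℚ F : ℝ) * Real.log (max 1 (Hκ : ℝ)))))
          ≤ ‖α - Complex.exp ∘ s‖

end Summit.Schanuel.Schanuel.Cruxes.KhovanskiiApproxTypeEv.IdeateR1K2

end
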